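import Summits.CriticalPhenomena.CardyFormulaZ2.Theorems.CardyUSTContinuationKirchhoffExtremalLengthG02Limsup
import Summits.CriticalPhenomena.CardyFormulaZ2.Theorems.CardyUSTContinuationKirchhoffExtremalLengthG02Liminf
import Summits.CriticalPhenomena.CardyFormulaZ2.Theorems.CardyUSTContinuationKirchhoffExtremalLengthReduction

/-!
# `KirchhoffExtremalLength` (route CardyUSTContinuation of `CardyFormulaZ2`): proof

Closing file for item stmt-CriticalPhenomena-11234. The route decl
`Summit.CriticalPhenomena.CardyFormulaZ2.Theses.CardyUSTContinuation.KirchhoffExtremalLength`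
(Kirchhoff: the `t → 0⁺` slope of the FK crossing weight of a conformal rectangle at mesh `δ`
converges, as `δ → 0⁺`, in the sense of `HasCrossingLimit`, to the ratio of hypergeometric
functions of the cross-ratio) is equivalent (`kirchhoffExtremalLength_iff_g02ModulusConvergence`,
`…Reduction.lean`) to `G02ModulusConvergence` (`…Defs.lean`): for every conformal rectangle the
unit-conductance effective conductance between the discrete arcs `A_δ`, `B_δ` of `(ab)`, `(cd)` in
`Ω_δ = discreteDomainGraph Ω δ` converges, along ALL meshes `δ → 0⁺`, to `d_Ω((ab),(cd))⁻¹`.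
This is [GP19] Cor 4.15 for the `meshDomain`/`discreteArc` discretisation and arbitrary meshes,
assembled here from the two halves proved in this series by transposing the tree's formalisation
of [GP19] §3–4: `inv_extremalDistance_le_of_subseq'` (`…G02Liminf.lean`, potentials) and
`le_inv_extremalDistance_of_subseq_of_disjoint'` (`…G02Limsup.lean`, discrete harmonic
conjugates), via sequential compactness of `ℝ≥0∞`.
-/

noncomputable section

namespace Summit.CriticalPhenomena.CardyFormulaZ2.Theorems

namespace KirchhoffSlope

open Set Metric Filter Topology
open scoped ENNReal NNReal
open Literature.Probability Literature.Probability.LatticeModels Literature.Probability.Percolation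
open Literature.Probability.RandomPlanarGeometry Literature.Analysis.Complex

/-- **`lim 𝒞(A_δ ↔ B_δ; Ω_δ) ≤ d_Ω((ab),(cd))⁻¹` along EVERY sequence of meshes `δ_n → 0⁺`** (the
discrete arcs are disjoint for small meshes, `eventually_discreteArc_inter_eq_empty`, so
`le_inv_extremalDistance_of_subseq_of_disjoint'` applies to a tail of the sequence).
[cite: GeorgakopoulosPanagiotis2019, Cor 4.15] -/
theorem le_inv_extremalDistance_of_subseq' (R : ConformalRectangle) {δs : ℕ → ℝ}
    (hδ : ∀ n, 0 < δs n) (hδ0 : Tendsto δs atTop (𝓝 0)) {I : ℝ≥0∞}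
    (hI : Tendsto (fun n => effectiveConductance (discreteDomainGraph R.carrier (δs n)) 1
      (discreteArc R.carrier (δs n) (R.arc 0)) (discreteArc R.carrier (δs n) (R.arc 2))) atTop (𝓝 I)) :
    I ≤ (extremalDistance R.carrier (R.arc 0) (R.arc 2))⁻¹ := by
  obtain ⟨δ₀, hδ₀, hdisj⟩ := Literature.Probability.Percolation.eventually_discreteArc_inter_eq_empty R
  obtain ⟨N₀, hN₀⟩ := eventually_atTop.1 ((tendsto_order.1 hδ0).2 _ hδ₀)
  have hshift : Tendsto (fun n => n + N₀) atTop atTop := tendsto_add_atTop_nat N₀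
  exact le_inv_extremalDistance_of_subseq_of_disjoint' R (δs := fun n => δs (n + N₀)) (fun n => hδ _)
    (hδ0.comp hshift) (fun n => hdisj _ (hδ _) (hN₀ _ (Nat.le_add_left _ _))) (hI.comp hshift)

/-- **[GP19] Cor 4.15 for `Ω_δ = discreteDomainGraph Ω δ`, all meshes, in `ℝ≥0∞`**: for every
conformal rectangle, `𝒞(A_δ ↔ B_δ; Ω_δ) → d_Ω((ab),(cd))⁻¹` as `δ → 0⁺`. Every sequence of
meshes `δ_n → 0⁺` has a subsequence along which the conductances converge in the compact
`ℝ≥0∞`, and by the two halves the limit is `d_Ω((ab),(cd))⁻¹`. [cite: GeorgakopoulosPanagiotis2019, Cor 4.15] -/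
theorem tendsto_effectiveConductance_discreteArc (R : ConformalRectangle) :
    Tendsto (fun δ : ℝ => effectiveConductance (discreteDomainGraph R.carrier δ) 1
      (discreteArc R.carrier δ (R.arc 0)) (discreteArc R.carrier δ (R.arc 2))) (𝓝[>] 0)
      (𝓝 (extremalDistance R.carrier (R.arc 0) (R.arc 2))⁻¹) := by
  set lam := extremalDistance R.carrier (R.arc 0) (R.arc 2) with hlam
  set C : ℝ → ℝ≥0∞ := fun δ => effectiveConductance (discreteDomainGraph R.carrier δ) 1
    (discreteArc R.carrier δ (R.arc 0)) (discreteArc R.carrier δ (R.arc 2)) with hC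
  rw [tendsto_iff_seq_tendsto]
  intro x hx
  obtain ⟨hx0, hxpos⟩ := tendsto_nhdsWithin_iff.1 hx
  obtain ⟨N, hN⟩ := eventually_atTop.1 hxpos
  rw [← Filter.tendsto_add_atTop_iff_nat N]
  set δs : ℕ → ℝ := fun n => x (n + N) with hδs
  have hδ : ∀ n, 0 < δs n := fun n => hN _ (Nat.le_add_left _ _)
  have hδ0 : Tendsto δs atTop (𝓝 0) := hx0.comp (tendsto_add_atTop_nat N)
  change Tendsto (fun n => C (δs n)) atTop (𝓝 lam⁻¹)
  refine tendsto_of_subseq_tendsto fun ns hns => ?_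
  obtain ⟨J, ms, hms, hJ⟩ := SeqCompactSpace.tendsto_subseq (fun n => C (δs (ns n)))
  have hδ' : ∀ n, 0 < δs (ns (ms n)) := fun n => hδ _
  have hδ'0 : Tendsto (fun n => δs (ns (ms n))) atTop (𝓝 0) := hδ0.comp (hns.comp hms.tendsto_atTop)
  have hJ' : Tendsto (fun n => C (δs (ns (ms n)))) atTop (𝓝 J) := hJ
  have h1 : J ≤ lam⁻¹ := le_inv_extremalDistance_of_subseq' R hδ' hδ'0 hJ'
  have h2 : lam⁻¹ ≤ J := inv_extremalDistance_le_of_subseq' R hδ' hδ'0 hJ'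
  exact ⟨ms, by rw [le_antisymm h1 h2] at hJ'; exact hJ'⟩

/-- **`G02ModulusConvergence` holds**: for every conformal rectangle,
`𝒞(A_δ ↔ B_δ; Ω_δ).toReal → (d_Ω((ab),(cd))⁻¹).toReal` as `δ → 0⁺` (the limit is finite since the
conductances are eventually bounded, `eventually_effectiveConductance_discreteArc_le`).
[cite: GeorgakopoulosPanagiotis2019, Cor 4.15] -/
theorem g02ModulusConvergence_holds : G02ModulusConvergence := by
  intro R
  have hT := tendsto_effectiveConductance_discreteArc R
  obtain ⟨K, hK⟩ := eventually_effectiveConductance_discreteArc_le R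
  have hle : (extremalDistance R.carrier (R.arc 0) (R.arc 2))⁻¹ ≤ K := le_of_tendsto hT hK
  have hne : (extremalDistance R.carrier (R.arc 0) (R.arc 2))⁻¹ ≠ ⊤ := ne_top_of_le_ne_top ENNReal.coe_ne_top hle
  exact (ENNReal.tendsto_toReal hne).comp hT

end KirchhoffSlope

/-- **`KirchhoffExtremalLength`** (route CardyUSTContinuation of `CardyFormulaZ2`, item
stmt-CriticalPhenomena-11234): the `t → 0⁺` slope of the FK crossing weight of `Ω_δ` — by
Kirchhoff's theorem the effective conductance between the discrete arcs — converges as `δ → 0⁺`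
to the conformally invariant limit given by the ratio `₂F₁(½,½;1;η) / ₂F₁(½,½;1;1-η)` of the
cross-ratio. Proof: `G02ModulusConvergence` (`g02ModulusConvergence_holds`, [GP19] Cor 4.15 for
the `meshDomain`/`discreteArc` discretisation along all meshes) and the reduction
`kirchhoffExtremalLength_of_G02ModulusConvergence`. [cite: GeorgakopoulosPanagiotis2019, Cor 4.15] -/
theorem kirchhoffExtremalLength_proof :
    Summit.CriticalPhenomena.CardyFormulaZ2.Theses.CardyUSTContinuation.KirchhoffExtremalLength :=
  KirchhoffSlope.kirchhoffExtremalLength_of_G02ModulusConvergence KirchhoffSlope.g02ModulusConvergence_holds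

end Summit.CriticalPhenomena.CardyFormulaZ2.Theorems
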